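import Summits.BirchSwinnertonDyer.Rank1Residual.GaloisImage.ThreeCongruenceHesseCertificatesBatch1
import Summits.BirchSwinnertonDyer.Rank1Residual.Additive.X4ThreeVisibleRowShape7704q1
import Summits.BirchSwinnertonDyer.Rank1Residual.Additive.X4ThreeVisibleRowShape15129e1
import Summits.BirchSwinnertonDyer.Rank1Residual.Additive.X4ThreeVisibleRowShape17208i1
import Summits.BirchSwinnertonDyer.Rank1Residual.Additive.X4ThreeVisibleRowShape13248bm1
import Summits.BirchSwinnertonDyer.Rank1Residual.Additive.X4ThreeVisibleRowShape19575h1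
import Summits.BirchSwinnertonDyer.Rank1Residual.Additive.X4ThreeVisibleRowShape19575j1
import Summits.BirchSwinnertonDyer.Rank1Residual.Additive.X4ThreeVisibleRowShape19809d1
import Summits.BirchSwinnertonDyer.BirchSwinnertonDyer.Theorems.Rank2ObservatoryKernelCerts122
import Summits.BirchSwinnertonDyer.BirchSwinnertonDyer.Theorems.Rank2ObservatoryKernelCerts323
import Summits.BirchSwinnertonDyer.BirchSwinnertonDyer.Theorems.Rank2ObservatoryKernelCerts385
import Summits.BirchSwinnertonDyer.BirchSwinnertonDyer.Theorems.Rank2ObservatoryKernelCertsT60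
import Summits.BirchSwinnertonDyer.BirchSwinnertonDyer.Theorems.Rank2ObservatoryKernelCertsQ01
import Summits.BirchSwinnertonDyer.BirchSwinnertonDyer.Theorems.Rank2ObservatoryRank3Witness
import Summits.BirchSwinnertonDyer.BirchSwinnertonDyer.Theorems.Rank2ObservatoryKernelPrimes
import HarnessLib

/-!
# The seven T-VIS3-REC batch-1 row shapes with the C-VIS `θ/hθ` column AND the rank column
# `hrank` DISCHARGED IN THE KERNEL — binders left = named facts + the analytic EVIDENCE columns
# (`r_an = 0`, `ord₃ #Ш_an ≤ 2`) (+ Manin datum on (G) rows, + A243 on the two dual rows)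
# (cell `b2b-bsdres`, team n1011, ROW T-VIS3-TH FILE 2; seat p07 (gen 10); skeleton
# cells/n1011/skel/T-VIS3-TH.md; p18's shapes consumed BY NAME, nothing of p18's edited)

HONEST FRAMING (cell `b2b-bsdres`, run/shared/lean/b2b/bsd-rank1-residual/, verbatim in every
file): the goal of the cell is to DELETE the COMBINATION-SHAPED residual classes of the
Birch–Swinnerton-Dyer formula for ALL analytic-rank `≤ 1` elliptic curves over `ℚ` — "full BSD
formula for every rank `≤ 1` curve in class `C`" assembled STRICTLY from published theorems — so
that the rank-`≤ 1` remainder becomes exactly the CONSTRUCTION-SHAPED classes, which are TYPED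
(missing-input `Prop`s), NOT attempted. This is not "finishing BSD". Team n1011 (N11 = X4 ∧ `p = 3`):
research route; RECORD theorems only — NO definition, NO new named fact, NO `sorry`; a record closes
NO class and moves no mark / label / count; nothing booked (referee A's ledger); census count
unchanged.

RULING OF RECORD (n1011 lead GEN 8, R5-82 (d), verbatim): "T-VIS3 (iv) ROW SHAPE — evidence columns
displayed as binders, provenance: θ = r1 g29 tables (+ KO/Fisher certificate when landed), rank E′ =
Cremona/bsdr2, r_an/#Ш_an = Cremona allbsd + engine P; nothing booked; closes nothing beyond its
displayed binders; census count unchanged". This file lands the "Fisher certificate" for `θ` (ROW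
T-VIS3-TH FILE 1) and READS the bsd-rank2-observatory's KERNEL certificates for `rank E′ ≥ 2` (tree
theorems `Rank2Observatory.KernelCerts<…>.C<E′>.two_le_rank`, by name) into p18's seven shapes.

## What

For each batch-1 row `E` of n1011-p18's `Additive/X4ThreeVisibleRowShape<E>.lean` (`bsdp3_vis_v<E>`,
ALL seven ACCEPTED): **`bsdp3_visHesse_v<E>`** = `bsdp3_vis_v<E>` with
* `(W') (hW') [W'.IsElliptic] (θ) (hθ)` ↦ the literal partner, its ellipticity by `norm_num`, and
  `VisCerts.torsionIso3_<E′>_<E>_of_integralModelInt` (FILE 1: Fisher's `n = 3` Hesse pencil,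
  UNCONDITIONAL on the five direct pairs; the two dual pairs `15129e1`, `19809d1` keep
  `(hF' : thm132rev_threeCongruent_dualHessePencil)` = registered fact A243 until n1011-p02's
  T-F132-3R lands);
* `(hrank : 2 ≤ W'.mordellWeilRank)` ↦ `KernelCerts122.C7704r1` / `KernelCerts323.C15129d1` /
  `KernelCerts385.C17208k1` / `KernelCertsT60.C13248bn1` / `KernelCertsQ01.C2175c1` `.two_le_rank`
  (bsd-rank2-observatory, `Summits/BirchSwinnertonDyer/BirchSwinnertonDyer/Theorems/`), and for
  `59427a1` (no observatory certificate: its listed generators `(-66, 68)`, `(360, 6174)` have the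
  NON-integral sum `(-659/9, 2909/27)`) the certificate `VisCertsRank.C59427a1.two_le_rank` of §0 in
  the observatory's own format on the SCALED model `d = 3` (`scaleModel`, `mordellWeilRank_scaleModel`):
  `P₁ = (-594, 1836)`, `P₂ = (3240, 166698)`, `P₁ + P₂ = (-659, 2909)`, odd annihilator `t = 1` from
  the kernel counts `(ℓ, #Ẽ(𝔽_ℓ)) ∈ [(2, 4), (7, 7)]`, doubling witnesses at `q = 2, 2, 5`.

| row `E` | partner `E′` | `θ` | `rank E′ ≥ 2` | binders left besides the named facts |
|---|---|---|---|---|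
| 7704q1 (M) | 7704r1 | kernel | kernel (bsdr2) | `hr`, `hq/hv` |
| 15129e1 (M) | 15129d1 | kernel mod A243 | kernel (bsdr2) | `hF'`, `hr`, `hq/hv` |
| 17208i1 (M) | 17208k1 | kernel | kernel (bsdr2) | `hr`, `hq/hv` |
| 13248bm1 (G) | 13248bn1 | kernel | kernel (bsdr2) | `hr`, `D/hc`, `hq/hv` |
| 19575h1 (G) | 2175c1 | kernel | kernel (bsdr2) | `hr`, `D/hc`, `hq/hv` |
| 19575j1 (G) | 2175c1 | kernel | kernel (bsdr2) | `hr`, `D/hc`, `hq/hv` |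
| 19809d1 (G) | 59427a1 | kernel mod A243 | kernel (§0 here) | `hF'`, `hr`, `D/hc`, `hq/hv` |

So on every batch-1 row the ALGEBRAIC side of Cremona–Mazur visibility (`E′[3] ≅ E[3]`, `rank E′ ≥
2`, every local binder) is a kernel fact; what stays displayed is exactly the ANALYTIC evidence
(`r_an(E) = 0`, `ord₃ #Ш_an(E) ≤ 2`) (+ the Manin datum `3 ∤ c_D` on (G) rows) and the named facts
of the (M)/(G) chains. Closes nothing beyond the displayed binders; nothing booked.

References: J. Cremona, B. Mazur, *Visualizing elements in the Shafarevich–Tate group*, Exp. Math. 9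
(2000) §3 [CremonaMazur2000]; A. Agashe, W. Stein, J. Number Theory 97 (2002) Thm. 3.1
[AgasheStein2002]; T. Fisher, Proc. LMS 104 (2012) Thm. 13.2, §13 [Fisher2012Hessian]; J. Cremona,
*Algorithms for Modular Elliptic Curves* (1997) §3.5 [CremonaAlgorithms1997]; J. H. Silverman, *AEC*
(2009) VII.3.1(b), VIII.6.7 [SilvermanAEC2009]; cells/n1011/skel/T-VIS3-TH.md; n1011-p18 GEN 8/9
(row shapes); bsd-rank2-observatory (kernel rank certificates).
-/

set_option autoImplicit false

noncomputable section

open scoped Classical NumberField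
open IsDedekindDomain NumberField WeierstrassCurve Rat.HeightOneSpectrum
  Literature.NumberTheory.EllipticCurves Literature.NumberTheory.EllipticCurves.ModularForms
  Literature.NumberTheory.EllipticCurves.Rank1Residual
  Literature.NumberTheory.EllipticCurves.Rank1Residual.Typed
  Literature.NumberTheory.EllipticCurves.Fisher2012
  Literature.NumberTheory.GaloisRepresentations
  Summit.BirchSwinnertonDyer.BirchSwinnertonDyer.Rank1Residual.IntModel
  Summit.BirchSwinnertonDyer.BirchSwinnertonDyer.Rank1Residual.X11RankOne
  Summit.BirchSwinnertonDyer.BirchSwinnertonDyer.Rank2Observatory.Tam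
  Summit.BirchSwinnertonDyer.BirchSwinnertonDyer.Rank2Observatory
  Summit.BirchSwinnertonDyer.Rank1Residual.GaloisImage

namespace Summit.BirchSwinnertonDyer.Rank1Residual.Additive

/-! ### §0 The rank certificate of `59427a1` (partner of `19809d1`), observatory format, scaled model -/

namespace VisCertsRank.C59427a1

/-- Killers for the scaled model `V₃ = [3, -9, 27, -1230471, -517990950]` of `59427a1` (`d = 3`)
from the kernel counts `(ℓ, #Ẽ(𝔽_ℓ)) ∈ [(2, 4), (7, 7)]`. [cite: SilvermanAEC2009, Prop. VII.3.1(b)] -/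
theorem killers : ∀ ℓN ∈ [((2 : ℕ), (4 : ℕ)), (7, 7)], ℓN.1.Prime ∧
    ∀ (x : ((⟨3, -9, 27, -1230471, -517990950⟩ : WeierstrassCurve ℤ).map
        (Int.castRingHom ℚ)).toAffine.Point) (n : ℕ), ¬ ℓN.1 ∣ n → n • x = 0 → ℓN.2 • x = 0 :=
  killers_cons _ (q := 2) (N := 4) (by decide +kernel) (by decide +kernel)
      (killers_cons _ (q := 7) (N := 7) (by decide +kernel) (by decide +kernel)
      (killers_nil _))

/-- **`2 ≤ rank_ℤ` of the SCALED model `V₃ = scaleModel [1,-1,1,-15191,-710550] 3`** (on which the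
listed generators of `59427a1` and their sum are integral): observatory kernel certificate with
`P₁ = (-594, 1836)`, `P₂ = (3240, 166698)`, `P₁ + P₂ = (-659, 2909)`, odd torsion annihilator `t = 1`
from `ℓ = 2, 7`, doubling witnesses at `q = 2, 2, 5`. [cite: CremonaAlgorithms1997, §3.5]
[cite: SilvermanAEC2009, Thm. VIII.6.7] -/
theorem two_le_rank_scaled :
    2 ≤ ((⟨3, -9, 27, -1230471, -517990950⟩ : WeierstrassCurve ℤ).map
      (Int.castRingHom ℚ)).mordellWeilRank :=
  two_le_mordellWeilRank_of_kernelCert _ (X₁ := -594) (Y₁ := 1836) (X₂ := 3240) (Y₂ := 166698)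
    (X₃ := -659) (Y₃ := 2909) (by decide +kernel) (by decide +kernel) (by decide +kernel)
    (by decide +kernel) (t := 1) (by decide) killers (by decide +kernel) 2 2 5
    (by decide +kernel) (by decide +kernel) (by decide +kernel) (by decide +kernel)
    (by decide +kernel) (by decide +kernel)

/-- **`2 ≤ rank_ℤ E(ℚ)` for `59427a1 = [1,-1,1,-15191,-710550]`** (Cremona: rank `2`, generators
`(-66, 68)`, `(360, 6174)`, trivial torsion): the scaled certificate transported by
`mordellWeilRank_scaleModel` (`(x, y) ↦ (9x, 27y)`, Silverman *AEC* III.3.1(b)).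
[cite: CremonaAlgorithms1997, §3.5] [cite: SilvermanAEC2009, III.3.1(b) and Thm. VIII.6.7] -/
theorem two_le_rank :
    2 ≤ ((⟨1, -1, 1, -15191, -710550⟩ : WeierstrassCurve ℤ).map (Int.castRingHom ℚ)).mordellWeilRank := by
  have h := mordellWeilRank_scaleModel (⟨1, -1, 1, -15191, -710550⟩ : WeierstrassCurve ℤ) (d := 3)
    (by norm_num)
  have hs : scaleModel (⟨1, -1, 1, -15191, -710550⟩ : WeierstrassCurve ℤ) 3 =
      ⟨3, -9, 27, -1230471, -517990950⟩ := by
    simp only [scaleModel]; norm_num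
  rw [hs] at h
  rw [← h]
  exact two_le_rank_scaled

end VisCertsRank.C59427a1

/-! ### §1 The seven rows -/

/-- **T-VIS3 row `7704q1` with the C-VIS `θ/hθ` column AND the rank column `hrank` DISCHARGED IN THE
KERNEL** — p18's row shape `bsdp3_vis_v7704q1` (`BSD(E,3)` for `E = 7704q1 = [0, 0, 0, -1545392343,
-23383324023721]` from its `3`-congruent rank-2 partner `E′ = 7704r1 = [0, 0, 0, -183, 911]`, every
local binder in the kernel) fed with `VisCerts.torsionIso3_7704r1_7704q1_of_integralModelInt` (ROW
T-VIS3-TH FILE 1: DIRECT certificate (−544719 : 2), u = 243) and with `2 ≤ rank E′(ℚ)` from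
bsd-rank2-observatory KERNEL certificate `Rank2Observatory.KernelCerts122.C7704r1.two_le_rank`.
BINDERS LEFT = {named facts, hr (r_an = 0), hq/hv (ord₃ #Ш_an ≤ 2)} — the analytic EVIDENCE columns
only (lead R5-82 (d)); the partner `E′` no longer appears in the statement (its ellipticity, the
congruence and its rank are kernel facts); closes nothing beyond the displayed binders; nothing
booked; census count unchanged.
[cite: CremonaMazur2000, §3 and Table 1] [cite: Fisher2012Hessian, Thm. 13.2 (n = 3)] -/
theorem bsdp3_visHesse_v7704q1
    (hKatoS : Kato2004.rankZero_padicValNat_sha_le_sub_localTamagawa_of_additive_potGood_of_imageContainsSL2)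
    (hDel : Delbourgo1998.prop4_rankZero_pow_dvd_constantCoeff)
    (hGZK : rank_eq_analyticRank_of_analyticRank_le_one) (hmod : hasEntireLFunction_rat)
    (hmodD : nonempty_modularParametrizationData)
    (hKatoχ : Wuthrich2014.kato_halfEigenCharIdeal_dvd_cyclotomicPrime_of_surjective)
    (hCT : exists_casselsTate_pairing (K := ℚ))
    (W : WeierstrassCurve ℚ) [W.IsElliptic] [W.IsGloballyMinimal]
    (hI : integralModelInt W = ⟨0, 0, 0, -1545392343, -23383324023721⟩)
    (hr : W.analyticRank = 0)
    {q : ℚ} (hq : shaAn W = (q : ℂ)) (hv : padicValRat 3 q ≤ 2) :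
    haveI : Fact (Nat.Prime 3) := ⟨Nat.prime_three⟩
    BSDp W 3 := by
  haveI : (⟨0, 0, 0, -183, 911⟩ : WeierstrassCurve ℚ).IsElliptic :=
    ⟨by rw [isUnit_iff_ne_zero]
        norm_num [WeierstrassCurve.Δ, WeierstrassCurve.b₂, WeierstrassCurve.b₄, WeierstrassCurve.b₆,
          WeierstrassCurve.b₈]⟩
  obtain ⟨θ, hθ⟩ := VisCerts.torsionIso3_7704r1_7704q1_of_integralModelInt W hI ⟨0, 0, 0, -183, 911⟩ rfl
  have hE' : (⟨0, 0, 0, -183, 911⟩ : WeierstrassCurve ℤ).map (Int.castRingHom ℚ) =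
      (⟨0, 0, 0, -183, 911⟩ : WeierstrassCurve ℚ) := by
    ext <;> simp [WeierstrassCurve.map]
  have hrank : 2 ≤ (⟨0, 0, 0, -183, 911⟩ : WeierstrassCurve ℚ).mordellWeilRank := by
    rw [← hE']; exact KernelCerts122.C7704r1.two_le_rank
  exact bsdp3_vis_v7704q1 hKatoS hDel hGZK hmod hmodD hKatoχ hCT W hI hr hq hv _ rfl θ hθ hrank

/-- **T-VIS3 row `15129e1` with the C-VIS `θ/hθ` column AND the rank column `hrank` DISCHARGED IN THE
KERNEL** — p18's row shape `bsdp3_vis_v15129e1` (`BSD(E,3)` for `E = 15129e1 = [0, 0, 1, -156333,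
-25414619]` from its `3`-congruent rank-2 partner `E′ = 15129d1 = [1, -1, 1, -131, 600]`, every
local binder in the kernel) fed with `VisCerts.torsionIso3_15129d1_15129e1_of_integralModelInt` (ROW
T-VIS3-TH FILE 1: DUAL certificate (−5658 : 1), u = 1/246 — anti-symplectic, modulo
`thm132rev_threeCongruent_dualHessePencil` (`hF'`)) and with `2 ≤ rank E′(ℚ)` from
bsd-rank2-observatory KERNEL certificate `Rank2Observatory.KernelCerts323.C15129d1.two_le_rank`.
BINDERS LEFT = {named facts + hF' (A243), hr (r_an = 0), hq/hv (ord₃ #Ш_an ≤ 2)} — the analytic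
EVIDENCE columns only (lead R5-82 (d)); the partner `E′` no longer appears in the statement (its
ellipticity, the congruence and its rank are kernel facts); closes nothing beyond the displayed
binders; nothing booked; census count unchanged.
[cite: CremonaMazur2000, §3 and Table 1] [cite: Fisher2012Hessian, §13 (analogue of Thm. 13.2 for X_E^-(3))] -/
theorem bsdp3_visHesse_v15129e1 (hF' : thm132rev_threeCongruent_dualHessePencil)
    (hKatoS : Kato2004.rankZero_padicValNat_sha_le_sub_localTamagawa_of_additive_potGood_of_imageContainsSL2)
    (hDel : Delbourgo1998.prop4_rankZero_pow_dvd_constantCoeff)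
    (hGZK : rank_eq_analyticRank_of_analyticRank_le_one) (hmod : hasEntireLFunction_rat)
    (hmodD : nonempty_modularParametrizationData)
    (hKatoχ : Wuthrich2014.kato_halfEigenCharIdeal_dvd_cyclotomicPrime_of_surjective)
    (hCT : exists_casselsTate_pairing (K := ℚ))
    (W : WeierstrassCurve ℚ) [W.IsElliptic] [W.IsGloballyMinimal]
    (hI : integralModelInt W = ⟨0, 0, 1, -156333, -25414619⟩)
    (hr : W.analyticRank = 0)
    {q : ℚ} (hq : shaAn W = (q : ℂ)) (hv : padicValRat 3 q ≤ 2) :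
    haveI : Fact (Nat.Prime 3) := ⟨Nat.prime_three⟩
    BSDp W 3 := by
  haveI : (⟨1, -1, 1, -131, 600⟩ : WeierstrassCurve ℚ).IsElliptic :=
    ⟨by rw [isUnit_iff_ne_zero]
        norm_num [WeierstrassCurve.Δ, WeierstrassCurve.b₂, WeierstrassCurve.b₄, WeierstrassCurve.b₆,
          WeierstrassCurve.b₈]⟩
  obtain ⟨θ, hθ⟩ := VisCerts.torsionIso3_15129d1_15129e1_of_integralModelInt hF' W hI ⟨1, -1, 1, -131, 600⟩ rfl
  have hE' : (⟨1, -1, 1, -131, 600⟩ : WeierstrassCurve ℤ).map (Int.castRingHom ℚ) =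
      (⟨1, -1, 1, -131, 600⟩ : WeierstrassCurve ℚ) := by
    ext <;> simp [WeierstrassCurve.map]
  have hrank : 2 ≤ (⟨1, -1, 1, -131, 600⟩ : WeierstrassCurve ℚ).mordellWeilRank := by
    rw [← hE']; exact KernelCerts323.C15129d1.two_le_rank
  exact bsdp3_vis_v15129e1 hKatoS hDel hGZK hmod hmodD hKatoχ hCT W hI hr hq hv _ rfl θ hθ hrank

/-- **T-VIS3 row `17208i1` with the C-VIS `θ/hθ` column AND the rank column `hrank` DISCHARGED IN THE
KERNEL** — p18's row shape `bsdp3_vis_v17208i1` (`BSD(E,3)` for `E = 17208i1 = [0, 0, 0, -11485911,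
-14982913897]` from its `3`-congruent rank-2 partner `E′ = 17208k1 = [0, 0, 0, -579, 5411]`, every
local binder in the kernel) fed with `VisCerts.torsionIso3_17208k1_17208i1_of_integralModelInt` (ROW
T-VIS3-TH FILE 1: DIRECT certificate (−23478 : 1), u = 54) and with `2 ≤ rank E′(ℚ)` from
bsd-rank2-observatory KERNEL certificate `Rank2Observatory.KernelCerts385.C17208k1.two_le_rank`.
BINDERS LEFT = {named facts, hr (r_an = 0), hq/hv (ord₃ #Ш_an ≤ 2)} — the analytic EVIDENCE columns
only (lead R5-82 (d)); the partner `E′` no longer appears in the statement (its ellipticity, the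
congruence and its rank are kernel facts); closes nothing beyond the displayed binders; nothing
booked; census count unchanged.
[cite: CremonaMazur2000, §3 and Table 1] [cite: Fisher2012Hessian, Thm. 13.2 (n = 3)] -/
theorem bsdp3_visHesse_v17208i1
    (hKatoS : Kato2004.rankZero_padicValNat_sha_le_sub_localTamagawa_of_additive_potGood_of_imageContainsSL2)
    (hDel : Delbourgo1998.prop4_rankZero_pow_dvd_constantCoeff)
    (hGZK : rank_eq_analyticRank_of_analyticRank_le_one) (hmod : hasEntireLFunction_rat)
    (hmodD : nonempty_modularParametrizationData)
    (hKatoχ : Wuthrich2014.kato_halfEigenCharIdeal_dvd_cyclotomicPrime_of_surjective)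
    (hCT : exists_casselsTate_pairing (K := ℚ))
    (W : WeierstrassCurve ℚ) [W.IsElliptic] [W.IsGloballyMinimal]
    (hI : integralModelInt W = ⟨0, 0, 0, -11485911, -14982913897⟩)
    (hr : W.analyticRank = 0)
    {q : ℚ} (hq : shaAn W = (q : ℂ)) (hv : padicValRat 3 q ≤ 2) :
    haveI : Fact (Nat.Prime 3) := ⟨Nat.prime_three⟩
    BSDp W 3 := by
  haveI : (⟨0, 0, 0, -579, 5411⟩ : WeierstrassCurve ℚ).IsElliptic :=
    ⟨by rw [isUnit_iff_ne_zero]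
        norm_num [WeierstrassCurve.Δ, WeierstrassCurve.b₂, WeierstrassCurve.b₄, WeierstrassCurve.b₆,
          WeierstrassCurve.b₈]⟩
  obtain ⟨θ, hθ⟩ := VisCerts.torsionIso3_17208k1_17208i1_of_integralModelInt W hI ⟨0, 0, 0, -579, 5411⟩ rfl
  have hE' : (⟨0, 0, 0, -579, 5411⟩ : WeierstrassCurve ℤ).map (Int.castRingHom ℚ) =
      (⟨0, 0, 0, -579, 5411⟩ : WeierstrassCurve ℚ) := by
    ext <;> simp [WeierstrassCurve.map]
  have hrank : 2 ≤ (⟨0, 0, 0, -579, 5411⟩ : WeierstrassCurve ℚ).mordellWeilRank := by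
    rw [← hE']; exact KernelCerts385.C17208k1.two_le_rank
  exact bsdp3_vis_v17208i1 hKatoS hDel hGZK hmod hmodD hKatoχ hCT W hI hr hq hv _ rfl θ hθ hrank

/-- **T-VIS3 row `13248bm1` with the C-VIS `θ/hθ` column AND the rank column `hrank` DISCHARGED IN THE
KERNEL** — p18's row shape `bsdp3_vis_v13248bm1` (`BSD(E,3)` for `E = 13248bm1 = [0, 0, 0, -1980,
-33912]` from its `3`-congruent rank-2 partner `E′ = 13248bn1 = [0, 0, 0, 180, 1296]`, every local
binder in the kernel) fed with `VisCerts.torsionIso3_13248bn1_13248bm1_of_integralModelInt` (ROW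
T-VIS3-TH FILE 1: DIRECT certificate (−312 : 1), u = 24) and with `2 ≤ rank E′(ℚ)` from
bsd-rank2-observatory KERNEL certificate `Rank2Observatory.KernelCertsT60.C13248bn1.two_le_rank`.
BINDERS LEFT = {named facts, hr (r_an = 0), hq/hv (ord₃ #Ш_an ≤ 2), D/hc (Manin datum)} — the
analytic EVIDENCE columns only (lead R5-82 (d)); the partner `E′` no longer appears in the statement
(its ellipticity, the congruence and its rank are kernel facts); closes nothing beyond the displayed
binders; nothing booked; census count unchanged.
[cite: CremonaMazur2000, §3 and Table 1] [cite: Fisher2012Hessian, Thm. 13.2 (n = 3)] -/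
theorem bsdp3_visHesse_v13248bm1
    (hKato : Kato2004.rankZero_padicValNat_sha_le_of_additive_potGood_of_imageContainsSL2)
    (hCT : exists_casselsTate_pairing (K := ℚ))
    (hGZK : rank_eq_analyticRank_of_analyticRank_le_one) (hmod : hasEntireLFunction_rat)
    (W : WeierstrassCurve ℚ) [W.IsElliptic] [W.IsGloballyMinimal]
    (hI : integralModelInt W = ⟨0, 0, 0, -1980, -33912⟩)
    (hr : W.analyticRank = 0)
    {N : ℕ} [NeZero N] (D : ModularParametrizationData W N) (hc : ¬ ((3 : ℕ) : ℤ) ∣ D.maninConstant)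
    {q : ℚ} (hq : shaAn W = (q : ℂ)) (hv : padicValRat 3 q ≤ 2) :
    haveI : Fact (Nat.Prime 3) := ⟨Nat.prime_three⟩
    BSDp W 3 := by
  haveI : (⟨0, 0, 0, 180, 1296⟩ : WeierstrassCurve ℚ).IsElliptic :=
    ⟨by rw [isUnit_iff_ne_zero]
        norm_num [WeierstrassCurve.Δ, WeierstrassCurve.b₂, WeierstrassCurve.b₄, WeierstrassCurve.b₆,
          WeierstrassCurve.b₈]⟩
  obtain ⟨θ, hθ⟩ := VisCerts.torsionIso3_13248bn1_13248bm1_of_integralModelInt W hI ⟨0, 0, 0, 180, 1296⟩ rfl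
  have hE' : (⟨0, 0, 0, 180, 1296⟩ : WeierstrassCurve ℤ).map (Int.castRingHom ℚ) =
      (⟨0, 0, 0, 180, 1296⟩ : WeierstrassCurve ℚ) := by
    ext <;> simp [WeierstrassCurve.map]
  have hrank : 2 ≤ (⟨0, 0, 0, 180, 1296⟩ : WeierstrassCurve ℚ).mordellWeilRank := by
    rw [← hE']; exact KernelCertsT60.C13248bn1.two_le_rank
  exact bsdp3_vis_v13248bm1 hKato hCT hGZK hmod W hI hr D hc hq hv _ rfl θ hθ hrank

/-- **T-VIS3 row `19575h1` with the C-VIS `θ/hθ` column AND the rank column `hrank` DISCHARGED IN THE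
KERNEL** — p18's row shape `bsdp3_vis_v19575h1` (`BSD(E,3)` for `E = 19575h1 = [1, -1, 1, -72378605,
-236930312978]` from its `3`-congruent rank-2 partner `E′ = 2175c1 = [1, 1, 1, -688, 6656]`, every
local binder in the kernel) fed with `VisCerts.torsionIso3_2175c1_19575h1_of_integralModelInt` (ROW
T-VIS3-TH FILE 1: DIRECT certificate (−705105 : 11), u = 1687500) and with `2 ≤ rank E′(ℚ)` from
bsd-rank2-observatory KERNEL certificate `Rank2Observatory.KernelCertsQ01.C2175c1.two_le_rank`.
BINDERS LEFT = {named facts, hr (r_an = 0), hq/hv (ord₃ #Ш_an ≤ 2), D/hc (Manin datum)} — the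
analytic EVIDENCE columns only (lead R5-82 (d)); the partner `E′` no longer appears in the statement
(its ellipticity, the congruence and its rank are kernel facts); closes nothing beyond the displayed
binders; nothing booked; census count unchanged.
[cite: CremonaMazur2000, §3 and Table 1] [cite: Fisher2012Hessian, Thm. 13.2 (n = 3)] -/
theorem bsdp3_visHesse_v19575h1
    (hKato : Kato2004.rankZero_padicValNat_sha_le_of_additive_potGood_of_imageContainsSL2)
    (hCT : exists_casselsTate_pairing (K := ℚ))
    (hGZK : rank_eq_analyticRank_of_analyticRank_le_one) (hmod : hasEntireLFunction_rat)
    (W : WeierstrassCurve ℚ) [W.IsElliptic] [W.IsGloballyMinimal]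
    (hI : integralModelInt W = ⟨1, -1, 1, -72378605, -236930312978⟩)
    (hr : W.analyticRank = 0)
    {N : ℕ} [NeZero N] (D : ModularParametrizationData W N) (hc : ¬ ((3 : ℕ) : ℤ) ∣ D.maninConstant)
    {q : ℚ} (hq : shaAn W = (q : ℂ)) (hv : padicValRat 3 q ≤ 2) :
    haveI : Fact (Nat.Prime 3) := ⟨Nat.prime_three⟩
    BSDp W 3 := by
  haveI : (⟨1, 1, 1, -688, 6656⟩ : WeierstrassCurve ℚ).IsElliptic :=
    ⟨by rw [isUnit_iff_ne_zero]
        norm_num [WeierstrassCurve.Δ, WeierstrassCurve.b₂, WeierstrassCurve.b₄, WeierstrassCurve.b₆,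
          WeierstrassCurve.b₈]⟩
  obtain ⟨θ, hθ⟩ := VisCerts.torsionIso3_2175c1_19575h1_of_integralModelInt W hI ⟨1, 1, 1, -688, 6656⟩ rfl
  have hE' : (⟨1, 1, 1, -688, 6656⟩ : WeierstrassCurve ℤ).map (Int.castRingHom ℚ) =
      (⟨1, 1, 1, -688, 6656⟩ : WeierstrassCurve ℚ) := by
    ext <;> simp [WeierstrassCurve.map]
  have hrank : 2 ≤ (⟨1, 1, 1, -688, 6656⟩ : WeierstrassCurve ℚ).mordellWeilRank := by
    rw [← hE']; exact KernelCertsQ01.C2175c1.two_le_rank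
  exact bsdp3_vis_v19575h1 hKato hCT hGZK hmod W hI hr D hc hq hv _ rfl θ hθ hrank

/-- **T-VIS3 row `19575j1` with the C-VIS `θ/hθ` column AND the rank column `hrank` DISCHARGED IN THE
KERNEL** — p18's row shape `bsdp3_vis_v19575j1` (`BSD(E,3)` for `E = 19575j1 = [0, 0, 1, -675,
-31219]` from its `3`-congruent rank-2 partner `E′ = 2175c1 = [1, 1, 1, -688, 6656]`, every local
binder in the kernel) fed with `VisCerts.torsionIso3_2175c1_19575j1_of_integralModelInt` (ROW
T-VIS3-TH FILE 1: DIRECT certificate (0 : 1), u = 540) and with `2 ≤ rank E′(ℚ)` from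
bsd-rank2-observatory KERNEL certificate `Rank2Observatory.KernelCertsQ01.C2175c1.two_le_rank`.
BINDERS LEFT = {named facts, hr (r_an = 0), hq/hv (ord₃ #Ш_an ≤ 2), D/hc (Manin datum)} — the
analytic EVIDENCE columns only (lead R5-82 (d)); the partner `E′` no longer appears in the statement
(its ellipticity, the congruence and its rank are kernel facts); closes nothing beyond the displayed
binders; nothing booked; census count unchanged.
[cite: CremonaMazur2000, §3 and Table 1] [cite: Fisher2012Hessian, Thm. 13.2 (n = 3)] -/
theorem bsdp3_visHesse_v19575j1
    (hKato : Kato2004.rankZero_padicValNat_sha_le_of_additive_potGood_of_imageContainsSL2)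
    (hCT : exists_casselsTate_pairing (K := ℚ))
    (hGZK : rank_eq_analyticRank_of_analyticRank_le_one) (hmod : hasEntireLFunction_rat)
    (W : WeierstrassCurve ℚ) [W.IsElliptic] [W.IsGloballyMinimal]
    (hI : integralModelInt W = ⟨0, 0, 1, -675, -31219⟩)
    (hr : W.analyticRank = 0)
    {N : ℕ} [NeZero N] (D : ModularParametrizationData W N) (hc : ¬ ((3 : ℕ) : ℤ) ∣ D.maninConstant)
    {q : ℚ} (hq : shaAn W = (q : ℂ)) (hv : padicValRat 3 q ≤ 2) :
    haveI : Fact (Nat.Prime 3) := ⟨Nat.prime_three⟩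
    BSDp W 3 := by
  haveI : (⟨1, 1, 1, -688, 6656⟩ : WeierstrassCurve ℚ).IsElliptic :=
    ⟨by rw [isUnit_iff_ne_zero]
        norm_num [WeierstrassCurve.Δ, WeierstrassCurve.b₂, WeierstrassCurve.b₄, WeierstrassCurve.b₆,
          WeierstrassCurve.b₈]⟩
  obtain ⟨θ, hθ⟩ := VisCerts.torsionIso3_2175c1_19575j1_of_integralModelInt W hI ⟨1, 1, 1, -688, 6656⟩ rfl
  have hE' : (⟨1, 1, 1, -688, 6656⟩ : WeierstrassCurve ℤ).map (Int.castRingHom ℚ) =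
      (⟨1, 1, 1, -688, 6656⟩ : WeierstrassCurve ℚ) := by
    ext <;> simp [WeierstrassCurve.map]
  have hrank : 2 ≤ (⟨1, 1, 1, -688, 6656⟩ : WeierstrassCurve ℚ).mordellWeilRank := by
    rw [← hE']; exact KernelCertsQ01.C2175c1.two_le_rank
  exact bsdp3_vis_v19575j1 hKato hCT hGZK hmod W hI hr D hc hq hv _ rfl θ hθ hrank

/-- **T-VIS3 row `19809d1` with the C-VIS `θ/hθ` column AND the rank column `hrank` DISCHARGED IN THE
KERNEL** — p18's row shape `bsdp3_vis_v19809d1` (`BSD(E,3)` for `E = 19809d1 = [0, 0, 1, -393,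
-2999]` from its `3`-congruent rank-2 partner `E′ = 59427a1 = [1, -1, 1, -15191, -710550]`, every
local binder in the kernel) fed with `VisCerts.torsionIso3_59427a1_19809d1_of_integralModelInt` (ROW
T-VIS3-TH FILE 1: DUAL certificate (−2618 : 19), u = 1/18 — anti-symplectic, modulo
`thm132rev_threeCongruent_dualHessePencil` (`hF'`)) and with `2 ≤ rank E′(ℚ)` from the kernel
certificate `VisCertsRank.C59427a1.two_le_rank` of §0 (bsdr2 format, scaled model `d = 3`). BINDERS
LEFT = {named facts + hF' (A243), hr (r_an = 0), hq/hv (ord₃ #Ш_an ≤ 2), D/hc (Manin datum)} — the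
analytic EVIDENCE columns only (lead R5-82 (d)); the partner `E′` no longer appears in the statement
(its ellipticity, the congruence and its rank are kernel facts); closes nothing beyond the displayed
binders; nothing booked; census count unchanged.
[cite: CremonaMazur2000, §3 and Table 1] [cite: Fisher2012Hessian, §13 (analogue of Thm. 13.2 for X_E^-(3))] -/
theorem bsdp3_visHesse_v19809d1 (hF' : thm132rev_threeCongruent_dualHessePencil)
    (hKato : Kato2004.rankZero_padicValNat_sha_le_of_additive_potGood_of_imageContainsSL2)
    (hCT : exists_casselsTate_pairing (K := ℚ))
    (hGZK : rank_eq_analyticRank_of_analyticRank_le_one) (hmod : hasEntireLFunction_rat)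
    (W : WeierstrassCurve ℚ) [W.IsElliptic] [W.IsGloballyMinimal]
    (hI : integralModelInt W = ⟨0, 0, 1, -393, -2999⟩)
    (hr : W.analyticRank = 0)
    {N : ℕ} [NeZero N] (D : ModularParametrizationData W N) (hc : ¬ ((3 : ℕ) : ℤ) ∣ D.maninConstant)
    {q : ℚ} (hq : shaAn W = (q : ℂ)) (hv : padicValRat 3 q ≤ 2) :
    haveI : Fact (Nat.Prime 3) := ⟨Nat.prime_three⟩
    BSDp W 3 := by
  haveI : (⟨1, -1, 1, -15191, -710550⟩ : WeierstrassCurve ℚ).IsElliptic :=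
    ⟨by rw [isUnit_iff_ne_zero]
        norm_num [WeierstrassCurve.Δ, WeierstrassCurve.b₂, WeierstrassCurve.b₄, WeierstrassCurve.b₆,
          WeierstrassCurve.b₈]⟩
  obtain ⟨θ, hθ⟩ := VisCerts.torsionIso3_59427a1_19809d1_of_integralModelInt hF' W hI ⟨1, -1, 1, -15191, -710550⟩ rfl
  have hE' : (⟨1, -1, 1, -15191, -710550⟩ : WeierstrassCurve ℤ).map (Int.castRingHom ℚ) =
      (⟨1, -1, 1, -15191, -710550⟩ : WeierstrassCurve ℚ) := by
    ext <;> simp [WeierstrassCurve.map]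
  have hrank : 2 ≤ (⟨1, -1, 1, -15191, -710550⟩ : WeierstrassCurve ℚ).mordellWeilRank := by
    rw [← hE']; exact VisCertsRank.C59427a1.two_le_rank
  exact bsdp3_vis_v19809d1 hKato hCT hGZK hmod W hI hr D hc hq hv _ rfl θ hθ hrank

end Summit.BirchSwinnertonDyer.Rank1Residual.Additive

end
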